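import Summits.CriticalPhenomena.PercolationContinuityZ3.Theorems.PercNearOneGluingNoHeavyLowerTailAntitheticTwinTopConnected
import HarnessLib

/-!
# `NoHeavyLowerTail` (stmt-CriticalPhenomena-4575) — antithetic cluster pairs: **THE TOP EVENT AT A TWIN — THE CUT THEOREM** (unifies
# THEOREM TA of …AntitheticTwinTop and THEOREM TC of …AntitheticTwinTopConnected; prim-hp-2 gen 73, HOME/THEOREM-TW.md §3)

Support file (`--supports stmt-CriticalPhenomena-4575`, hull-port prover `prim-hp-2`, gen 73).  No definitions, no named facts, no sorries;
standard axioms.  Notation of …AntitheticTwinTop: colourings `T ⊆ Sym2 V`, edge set `E`, source `s`, `X T = openCluster (T ∩ E) s`,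
`Y T = openCluster (Tᶜ ∩ E) s`; `s ≠ P` non-adjacent TWINS (`htwin`, `hsPE`), `N` = common neighbourhood, types RR/RB/BR of `v ∈ N` on the top
event `{P ∈ X T, P ∉ Y T}`.

Already in the tree: the red–red part (`Twin.top_rr_sum_nonneg`) and the cross part (`Twin.top_cross_sum_nonneg`: no red–red neighbour, a red
`E`-pair between a BR-vertex and an RB-vertex) of the top event are nonnegative on EVERY twin pair.  The REST of the top event consists of
colourings whose blue-`s` neighbours `J` (type BR) and red-`s` neighbours `K` (type RB) form a CUT of `N` CROSSED BY NO PAIR OF `E`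
(`Twin.cross_red_of_top`: a crossing pair would be red).  THIS FILE:
* `Antithetic.Twin.nested_of_rest` — if for every such cut `(J, K)` of the common neighbourhood every non-isolated vertex outside
  `N ∪ {s, P}` has a neighbour in `K` (hypothesis `hcut`, stated for all cuts of `N` without crossing pair), then on the rest of the top event
  the tops are NESTED (`Y T ⊆ X T`): a blue step into an extra vertex `w` either finds a red pair `wk` (`k ∈ K ⊆ X`) or a blue one (then
  `P ∈ Y` through `Pk`).
* `Antithetic.Twin.top_sum_nonneg_of_cut`, `Antithetic.Twin.vertex_sum_nonneg_of_cut` — **THEOREM TX (twin cut theorem)**: under `hcut`,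
  TOP(E; P) ≥ 0 in `K`-form and the |R| = 1 VERTEX ANTITHETIC INEQUALITY holds at `P`.  `hcut` is vacuous when `G[N]` is connected (THEOREM TC)
  and holds when every extra vertex is adjacent to all of `N` (THEOREM TA); new cases: `G[N]` with several components and extra vertices meeting
  every component (e.g. `N` = two disjoint edges `ab`, `cd`, every other vertex adjacent to one of `a, b` and one of `c, d`, arbitrary pairs
  among the extra vertices).
[cite: VandenbergHaggstromKahn2005, §1 p. 6 ("Harris' inequality"), §1 p. 3 (open cluster `C_s`)]
-/

noncomputable section

namespace Summit.CriticalPhenomena.PercolationContinuityZ3.Theorems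

open Literature.Probability.Percolation
open scoped Classical

namespace Antithetic

namespace Twin

variable {V : Type*}

/-- **Nested tops on the rest of the top event, under the cut hypothesis.**  Twins `s, P` (`sP ∉ E`); `hcut`: for every cut `S` of the
common neighbourhood crossed by no pair of `E`, every non-isolated vertex outside `N ∪ {s, P}` has a neighbour in `N ∖ S`.  If `P ∈ X T`,
`P ∉ Y T`, no common neighbour is red–red and no `E`-pair joins a blue-`s` neighbour to a red-`s` neighbour, then `Y T ⊆ X T`. [this work] -/
theorem nested_of_rest {E : Set (Sym2 V)} {s P : V} (hsP : s ≠ P) (hsPE : s(s, P) ∉ E)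
    (htwin : ∀ v, v ≠ s → v ≠ P → (s(s, v) ∈ E ↔ s(P, v) ∈ E))
    (hcut : ∀ S : Set V, (∃ j ∈ S, j ≠ s ∧ j ≠ P ∧ s(s, j) ∈ E) → (∃ k ∉ S, k ≠ s ∧ k ≠ P ∧ s(s, k) ∈ E) →
      (∀ j k, j ∈ S → k ∉ S → j ≠ s → j ≠ P → s(s, j) ∈ E → k ≠ s → k ≠ P → s(s, k) ∈ E → s(j, k) ∉ E) →
      ∀ w u, w ≠ s → w ≠ P → s(s, w) ∉ E → u ≠ w → s(u, w) ∈ E → ∃ k ∉ S, k ≠ s ∧ k ≠ P ∧ s(s, k) ∈ E ∧ s(w, k) ∈ E)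
    {T : Set (Sym2 V)} (hPX : P ∈ openCluster (T ∩ E) s) (hPY : P ∉ openCluster (Tᶜ ∩ E) s)
    (hnoRR : ∀ v, v ≠ s → v ≠ P → s(s, v) ∈ E → ¬ (s(s, v) ∈ T ∧ s(P, v) ∈ T))
    (hnoX : ∀ j k, j ≠ s → j ≠ P → s(s, j) ∈ E → k ≠ s → k ≠ P → s(s, k) ∈ E → s(s, j) ∉ T → s(s, k) ∈ T →
      s(j, k) ∈ E → s(j, k) ∉ T) :
    openCluster (Tᶜ ∩ E) s ⊆ openCluster (T ∩ E) s := by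
  -- the cut `S = {v | sv ∉ T}` (the blue-`s` side): both sides nonempty, no crossing pair
  let S : Set V := {v | s(s, v) ∉ T}
  have hJ : ∃ j ∈ S, j ≠ s ∧ j ≠ P ∧ s(s, j) ∈ E := by
    by_contra hJ
    have hPb : ∀ v, v ≠ s → v ≠ P → s(s, v) ∈ E → s(P, v) ∉ T := by
      intro v hvs hvP hvE hPv
      have hsv : s(s, v) ∈ T := by
        by_contra h
        exact hJ ⟨v, h, hvs, hvP, hvE⟩
      exact hnoRR v hvs hvP hvE ⟨hsv, hPv⟩
    have hXP : openCluster (T ∩ E) s ⊆ {u | u ≠ P} := by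
      refine TwoStage.Fan.cluster_subset_of_closed (show s ∈ {u : V | u ≠ P} from hsP) fun u w hu huw => ?_
      obtain ⟨⟨hTr, hE'⟩, hne⟩ := (openGraph_adj _ u w).1 huw
      intro hwP
      rw [hwP] at hTr hE' hne
      have hus : u ≠ s := by
        rintro rfl
        exact hsPE hE'
      have huE : s(s, u) ∈ E := (htwin u hus hne).2 (by rw [Sym2.eq_swap]; exact hE')
      exact hPb u hus hne huE (by rw [Sym2.eq_swap]; exact hTr)
    exact (hXP hPX) rfl
  have hK : ∃ k ∉ S, k ≠ s ∧ k ≠ P ∧ s(s, k) ∈ E := by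
    by_contra hK
    have hXs : openCluster (T ∩ E) s ⊆ {s} := by
      refine TwoStage.Fan.cluster_subset_of_closed (Set.mem_singleton s) fun u w hu huw => ?_
      obtain ⟨⟨hTr, hE'⟩, hne⟩ := (openGraph_adj _ u w).1 huw
      rw [Set.mem_singleton_iff] at hu
      subst hu
      exfalso
      by_cases hwP : w = P
      · exact hsPE (hwP ▸ hE')
      · exact hK ⟨w, fun h => h hTr, Ne.symm hne, hwP, hE'⟩
    exact hsP (Set.mem_singleton_iff.1 (hXs hPX)).symm
  have hnocross : ∀ j k, j ∈ S → k ∉ S → j ≠ s → j ≠ P → s(s, j) ∈ E → k ≠ s → k ≠ P → s(s, k) ∈ E → s(j, k) ∉ E := by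
    intro j k hj hk hjs hjP hjE hks hkP hkE hjkE
    have hsj : s(s, j) ∉ T := hj
    have hsk : s(s, k) ∈ T := by
      by_contra h
      exact hk h
    have hPk : s(P, k) ∉ T := fun h => hnoRR k hks hkP hkE ⟨hsk, h⟩
    have hjk : j ≠ k := fun h => hsj (h ▸ hsk)
    exact hnoX j k hjs hjP hjE hks hkP hkE hsj hsk hjkE (cross_red_of_top htwin hPY hjs hks hkP hjE hkE hsj hPk hjkE hjk)
  have hcut' := hcut S hJ hK hnocross
  -- the blue cluster lies in `X T ∩ Y T`, closed under blue pairs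
  suffices h : openCluster (Tᶜ ∩ E) s ⊆ openCluster (T ∩ E) s ∩ openCluster (Tᶜ ∩ E) s from fun u hu => (h hu).1
  refine TwoStage.Fan.cluster_subset_of_closed ⟨mem_openCluster_self _ s, mem_openCluster_self _ s⟩ fun u w hu huw => ?_
  obtain ⟨⟨hTb, hE⟩, hne⟩ := (openGraph_adj _ u w).1 huw
  have hwY : w ∈ openCluster (Tᶜ ∩ E) s := mem_blue_of_pair hu.2 hTb hE hne
  refine ⟨?_, hwY⟩
  by_cases hws : w = s
  · rw [hws]; exact mem_openCluster_self _ s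
  have hwP : w ≠ P := fun h => hPY (h ▸ hwY)
  by_cases hwN : s(s, w) ∈ E
  · exact nbr_mem_red_of_top htwin hPX hPY hws hwP hwN
  · -- an extra vertex: it has a neighbour `k` on the red-`s` side
    obtain ⟨k, hkS, hks, hkP, hkE, hwk⟩ := hcut' w u hws hwP hwN hne hE
    have hsk : s(s, k) ∈ T := by
      by_contra h
      exact hkS h
    have hkw : k ≠ w := fun h => hwN (h ▸ hkE)
    by_cases hred : s(w, k) ∈ T
    · have hkX : k ∈ openCluster (T ∩ E) s := mem_red_of_pair (mem_openCluster_self _ s) hsk hkE hks.symm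
      exact mem_red_of_pair hkX (by rw [Sym2.eq_swap]; exact hred) (by rw [Sym2.eq_swap]; exact hwk) hkw
    · exfalso
      have hkY : k ∈ openCluster (Tᶜ ∩ E) s := mem_blue_of_pair hwY hred hwk (Ne.symm hkw)
      have hPk : s(P, k) ∉ T := fun h => hnoRR k hks hkP hkE ⟨hsk, h⟩
      exact hPY (mem_blue_of_pair hkY (by rw [Sym2.eq_swap]; exact hPk) (by rw [Sym2.eq_swap]; exact (htwin k hks hkP).1 hkE) hkP)

variable [Fintype V]

/-- **THEOREM TX (twin cut theorem, top form, `K`-form).**  Twins `s ≠ P`, `sP ∉ E`; for every cut of the common neighbourhood crossed by no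
pair of `E`, every non-isolated vertex outside `N ∪ {s, P}` has a neighbour on the far side (`hcut`; vacuous if `G[N]` is connected, true if
every extra vertex is adjacent to all of `N`).  Then `0 ≤ Σ_{T : P ∈ X T, P ∉ Y T} K₁(X T, Y T)·K₂(X T, Y T)` for all super-odd
twisted-monotone `K₁, K₂`. [this work] -/
theorem top_sum_nonneg_of_cut (E : Set (Sym2 V)) (s P : V) (hsP : s ≠ P) (hsPE : s(s, P) ∉ E)
    (htwin : ∀ v, v ≠ s → v ≠ P → (s(s, v) ∈ E ↔ s(P, v) ∈ E))
    (hcut : ∀ S : Set V, (∃ j ∈ S, j ≠ s ∧ j ≠ P ∧ s(s, j) ∈ E) → (∃ k ∉ S, k ≠ s ∧ k ≠ P ∧ s(s, k) ∈ E) →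
      (∀ j k, j ∈ S → k ∉ S → j ≠ s → j ≠ P → s(s, j) ∈ E → k ≠ s → k ≠ P → s(s, k) ∈ E → s(j, k) ∉ E) →
      ∀ w u, w ≠ s → w ≠ P → s(s, w) ∉ E → u ≠ w → s(u, w) ∈ E → ∃ k ∉ S, k ≠ s ∧ k ≠ P ∧ s(s, k) ∈ E ∧ s(w, k) ∈ E)
    {K₁ K₂ : Set V → Set V → ℝ}
    (hK₁ : ∀ ⦃A A' B B' : Set V⦄, A ⊆ A' → B' ⊆ B → K₁ A B ≤ K₁ A' B') (hso₁ : ∀ A B, 0 ≤ K₁ A B + K₁ B A)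
    (hK₂ : ∀ ⦃A A' B B' : Set V⦄, A ⊆ A' → B' ⊆ B → K₂ A B ≤ K₂ A' B') (hso₂ : ∀ A B, 0 ≤ K₂ A B + K₂ B A) :
    0 ≤ ∑ T ∈ Finset.univ.filter (fun T : Set (Sym2 V) => P ∈ openCluster (T ∩ E) s ∧ P ∉ openCluster (Tᶜ ∩ E) s),
      K₁ (openCluster (T ∩ E) s) (openCluster (Tᶜ ∩ E) s) * K₂ (openCluster (T ∩ E) s) (openCluster (Tᶜ ∩ E) s) := by
  have hrr := top_rr_sum_nonneg E s P htwin hK₁ hso₁ hK₂ hso₂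
  have hcr := top_cross_sum_nonneg E s P htwin hK₁ hso₁ hK₂ hso₂
  -- the red–red part and the cross part are disjoint sub-events of the top event; off them the tops are nested
  have hdisj : Disjoint
      (Finset.univ.filter (fun T : Set (Sym2 V) => P ∈ openCluster (T ∩ E) s ∧ P ∉ openCluster (Tᶜ ∩ E) s ∧
        ∃ v, v ≠ s ∧ v ≠ P ∧ s(s, v) ∈ E ∧ s(s, v) ∈ T ∧ s(P, v) ∈ T))
      (Finset.univ.filter (fun T : Set (Sym2 V) => P ∈ openCluster (T ∩ E) s ∧ P ∉ openCluster (Tᶜ ∩ E) s ∧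
        (∀ v, v ≠ s → v ≠ P → s(s, v) ∈ E → ¬ (s(s, v) ∈ T ∧ s(P, v) ∈ T)) ∧
        ∃ j k, j ≠ s ∧ j ≠ P ∧ s(s, j) ∈ E ∧ k ≠ s ∧ k ≠ P ∧ s(s, k) ∈ E ∧ s(s, j) ∉ T ∧ s(s, k) ∈ T ∧
          s(j, k) ∈ E ∧ s(j, k) ∈ T)) := by
    rw [Finset.disjoint_filter]
    rintro T - ⟨-, -, v, hvs, hvP, hvE, h1, h2⟩ ⟨-, -, hno, -⟩
    exact hno v hvs hvP hvE ⟨h1, h2⟩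
  have hsum := add_nonneg hrr hcr
  rw [← Finset.sum_union hdisj] at hsum
  refine hsum.trans (Finset.sum_le_sum_of_subset_of_nonneg (fun T hT => ?_) (fun T hT hT' => ?_))
  · rw [Finset.mem_union] at hT
    simp only [Finset.mem_filter, Finset.mem_univ, true_and] at hT ⊢
    rcases hT with h | h
    · exact ⟨h.1, h.2.1⟩
    · exact ⟨h.1, h.2.1⟩
  · rw [Finset.mem_union, not_or] at hT'
    simp only [Finset.mem_filter, Finset.mem_univ, true_and] at hT hT'
    obtain ⟨hPX, hPY⟩ := hT
    obtain ⟨h1, h2⟩ := hT'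
    have hnoRR : ∀ v, v ≠ s → v ≠ P → s(s, v) ∈ E → ¬ (s(s, v) ∈ T ∧ s(P, v) ∈ T) :=
      fun v hvs hvP hvE h => h1 ⟨hPX, hPY, v, hvs, hvP, hvE, h.1, h.2⟩
    have hnoX : ∀ j k, j ≠ s → j ≠ P → s(s, j) ∈ E → k ≠ s → k ≠ P → s(s, k) ∈ E → s(s, j) ∉ T → s(s, k) ∈ T →
        s(j, k) ∈ E → s(j, k) ∉ T :=
      fun j k hjs hjP hjE hks hkP hkE hsj hsk hjkE hjk => h2 ⟨hPX, hPY, hnoRR, j, k, hjs, hjP, hjE, hks, hkP, hkE, hsj, hsk, hjkE, hjk⟩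
    have hYX := nested_of_rest hsP hsPE htwin hcut hPX hPY hnoRR hnoX
    have ha : 0 ≤ K₁ (openCluster (T ∩ E) s) (openCluster (Tᶜ ∩ E) s) := by
      have h' := hso₁ (openCluster (Tᶜ ∩ E) s) (openCluster (Tᶜ ∩ E) s)
      have h'' := hK₁ hYX (subset_refl (openCluster (Tᶜ ∩ E) s))
      linarith
    have hb : 0 ≤ K₂ (openCluster (T ∩ E) s) (openCluster (Tᶜ ∩ E) s) := by
      have h' := hso₂ (openCluster (Tᶜ ∩ E) s) (openCluster (Tᶜ ∩ E) s)
      have h'' := hK₂ hYX (subset_refl (openCluster (Tᶜ ∩ E) s))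
      linarith
    exact mul_nonneg ha hb

/-- **THEOREM TX (the |R| = 1 vertex antithetic inequality at a twin, cut form).**  Twins `s ≠ P`, `sP ∉ E`, satisfying the cut hypothesis
`hcut` (every cut of the common neighbourhood without crossing pair is seen from both sides by every non-isolated extra vertex).  Then for all
monotone `F, G`: `0 ≤ Σ_{T : ¬(P ∈ X T ∧ P ∈ Y T)} (F(X T) − F(Y T))·(G(X T) − G(Y T))`.  Contains THEOREM TA (…AntitheticTwinTop) and THEOREM TC
(…AntitheticTwinTopConnected). [this work] -/
theorem vertex_sum_nonneg_of_cut (E : Set (Sym2 V)) (s P : V) (hsP : s ≠ P) (hsPE : s(s, P) ∉ E)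
    (htwin : ∀ v, v ≠ s → v ≠ P → (s(s, v) ∈ E ↔ s(P, v) ∈ E))
    (hcut : ∀ S : Set V, (∃ j ∈ S, j ≠ s ∧ j ≠ P ∧ s(s, j) ∈ E) → (∃ k ∉ S, k ≠ s ∧ k ≠ P ∧ s(s, k) ∈ E) →
      (∀ j k, j ∈ S → k ∉ S → j ≠ s → j ≠ P → s(s, j) ∈ E → k ≠ s → k ≠ P → s(s, k) ∈ E → s(j, k) ∉ E) →
      ∀ w u, w ≠ s → w ≠ P → s(s, w) ∉ E → u ≠ w → s(u, w) ∈ E → ∃ k ∉ S, k ≠ s ∧ k ≠ P ∧ s(s, k) ∈ E ∧ s(w, k) ∈ E)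
    {F G : Set V → ℝ} (hF : Monotone F) (hG : Monotone G) :
    0 ≤ ∑ T ∈ Finset.univ.filter (fun T : Set (Sym2 V) =>
        ¬ ((openGraph (T ∩ E)).Reachable s P ∧ (openGraph (Tᶜ ∩ E)).Reachable s P)),
      (F (openCluster (T ∩ E) s) - F (openCluster (Tᶜ ∩ E) s)) * (G (openCluster (T ∩ E) s) - G (openCluster (Tᶜ ∩ E) s)) := by
  refine TopVertex.vertex_sum_nonneg_of_top E s P (fun F' G' hF' hG' => ?_) hF hG
  have hK₁ : ∀ ⦃A A' B B' : Set V⦄, A ⊆ A' → B' ⊆ B → F' A - F' B ≤ F' A' - F' B' :=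
    fun A A' B B' hA hB => sub_le_sub (hF' hA) (hF' hB)
  have hK₂ : ∀ ⦃A A' B B' : Set V⦄, A ⊆ A' → B' ⊆ B → G' A - G' B ≤ G' A' - G' B' :=
    fun A A' B B' hA hB => sub_le_sub (hG' hA) (hG' hB)
  have hso₁ : ∀ A B : Set V, 0 ≤ (F' A - F' B) + (F' B - F' A) := fun A B => by linarith
  have hso₂ : ∀ A B : Set V, 0 ≤ (G' A - G' B) + (G' B - G' A) := fun A B => by linarith
  exact top_sum_nonneg_of_cut E s P hsP hsPE htwin hcut (K₁ := fun A B => F' A - F' B) (K₂ := fun A B => G' A - G' B)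
    hK₁ hso₁ hK₂ hso₂

end Twin

end Antithetic

end Summit.CriticalPhenomena.PercolationContinuityZ3.Theorems
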